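import Mathlib
import Literature.Analysis.FluidPDE.Tao2016AveragedNS.ShiftSetCascadeFlux
import Summits.NavierStokesRegularity.NavierStokesRegularity.Theorems.TaoLadderRungTwoFlatGappedFrontRobustStepTransferOn
import HarnessLib

/-!
# Shift-set nonlinearity `quadTermOn 𝕊`: pointwise bilinear bounds on a nearest-neighbour shift set and
  the uniform time-Lipschitz bound for the deviation of two `PseudoFlowOnShift 𝕊` flows (helper for
  item stmt-NavierStokesRegularity-22988 `GappedFrontRobustV2Flat`, crux K_B♭ of route TaoLadderRungTwoFlat)

The `𝕊`-parametrised versions of the pointwise nonlinearity bounds of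
`Theorems/TaoLadderRungThreeGappedFrontRobustComparison.lean` / `…Lipschitz.lean` (p1 g9, one-way `S`):
for an ARBITRARY shift set `𝕊` the bilinear difference identity
`X_aX_b − Y_aY_b = (X_a − Y_a)X_b + Y_a(X_b − Y_b)` gives
`abs_quadTermOn_sub_quadTermOn_le`; when `𝕊` is NEAREST-NEIGHBOUR (`IsNearestNeighbourSet 𝕊`, tree:
`S` and `S♭` are) every triad based at shell `n` reads only the shells `n−1, n, n+1` with clock
`≤ (1+ε₀)^{5n/2}` (`ε₀ ≥ 0`), whence the THREE-SHELL forms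
`abs_quadTermOn_sub_quadTermOn_le_of_le` (`≤ 2 (∑|α_{··i·}|_𝕊) (1+ε₀)^{5n/2} A⋆ D⋆`),
`abs_quadTermOn_le_three_shell` (`≤ (∑|α_{··i·}|_𝕊) (1+ε₀)^{5n/2} A⋆²`, amplitudes bounded by `A⋆` on the
three shells only) and `abs_quadTermOn_le_of_uniform`; finally `pseudoFlowOnShift_sub_lipschitz`: the
deviation of a pseudo-flow and a defect-free flow is Lipschitz in time with the explicit constant
`4 (∑|α_{··i·}|_𝕊) (1+ε₀)^{5n/2} M² + κ₁ (1+ε₀)^{2n} M` (via `pseudoFlowOnShift_abs_sub_le`).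

HONEST FRAMING: elementary bookkeeping about Tao-type MODEL lattice nonlinearities/pseudo-flows on a
general shift set (Tao 2016 §4 (4.8), Lemma 4.1 (4.5)); nothing here is a statement about the
Navier–Stokes equations, and nothing is asserted about any table. Second table-generic layer of the S♭
port of K_B₂ (p1 g11).
-/

noncomputable section

-- the sub-problem namespace `Summit.NavierStokesRegularity.NavierStokesRegularity` repeats the summit name by design (D-0017)
set_option linter.dupNamespace false

namespace Summit.NavierStokesRegularity.NavierStokesRegularity.Theorems

open Set MeasureTheory intervalIntegral Literature.Analysis.FluidPDE Literature.Analysis.FluidPDE.TaoCascade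

namespace GappedFrontRobustOn

variable {m : ℕ} {𝕊 : Finset (ℤ × ℤ × ℤ)}

/-! ### Pointwise bilinear bounds -/

/-- The nonlinearity of the identically-zero family vanishes, on any shift set.
[cite: Tao2016AveragedNS, §4 (4.8)] -/
theorem quadTermOn_zero_family (𝕊 : Finset (ℤ × ℤ × ℤ)) (ε₀ : ℝ)
    (α : Fin m → Fin m → Fin m → ℤ × ℤ × ℤ → ℝ) (i : Fin m) (n : ℤ) (t : ℝ) :
    quadTermOn 𝕊 ε₀ α (fun _ _ _ => (0 : ℝ)) i n t = 0 := by
  simp [quadTermOn]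

/-- **Pointwise bilinear bound for the difference of the nonlinearities of two families** on an
arbitrary shift set `𝕊` (`1+ε₀ > 0`): with amplitude profile `A` bounding both families and `D`
bounding their difference at time `t`,
`|quadTermOn(X)_{i,n} − quadTermOn(Y)_{i,n}| ≤ ∑_{i₁,i₂,μ∈𝕊} |α| (1+ε₀)^{5(n−μ₃)/2} (D_a A_b + A_a D_b)`
with `a = n−μ₃+μ₁`, `b = n−μ₃+μ₂`. [cite: Tao2016AveragedNS, §4 (4.8) (the bilinear term)] -/
theorem abs_quadTermOn_sub_quadTermOn_le (ε₀ : ℝ) (hε : 0 < 1 + ε₀)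
    (α : Fin m → Fin m → Fin m → ℤ × ℤ × ℤ → ℝ) (X Y : Fin m → ℤ → ℝ → ℝ) (i : Fin m) (n : ℤ)
    (t : ℝ) {A D : ℤ → ℝ} (hAX : ∀ j k, |X j k t| ≤ A k) (hAY : ∀ j k, |Y j k t| ≤ A k)
    (hD : ∀ j k, |X j k t - Y j k t| ≤ D k) :
    |quadTermOn 𝕊 ε₀ α X i n t - quadTermOn 𝕊 ε₀ α Y i n t| ≤
      ∑ i₁, ∑ i₂, ∑ μ ∈ 𝕊, |α i₁ i₂ i μ| * (1 + ε₀) ^ ((5 : ℝ) * (n - μ.2.2) / 2) *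
        (D (n - μ.2.2 + μ.1) * A (n - μ.2.2 + μ.2.1) +
          A (n - μ.2.2 + μ.1) * D (n - μ.2.2 + μ.2.1)) := by
  have hdiff : quadTermOn 𝕊 ε₀ α X i n t - quadTermOn 𝕊 ε₀ α Y i n t =
      ∑ i₁, ∑ i₂, ∑ μ ∈ 𝕊, α i₁ i₂ i μ * (1 + ε₀) ^ ((5 : ℝ) * (n - μ.2.2) / 2) *
        (X i₁ (n - μ.2.2 + μ.1) t * X i₂ (n - μ.2.2 + μ.2.1) t -
          Y i₁ (n - μ.2.2 + μ.1) t * Y i₂ (n - μ.2.2 + μ.2.1) t) := by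
    unfold quadTermOn
    simp only [← Finset.sum_sub_distrib, ← mul_sub]
  rw [hdiff]
  refine (Finset.abs_sum_le_sum_abs _ _).trans (Finset.sum_le_sum fun i₁ _ => ?_)
  refine (Finset.abs_sum_le_sum_abs _ _).trans (Finset.sum_le_sum fun i₂ _ => ?_)
  refine (Finset.abs_sum_le_sum_abs _ _).trans (Finset.sum_le_sum fun μ _ => ?_)
  set a : ℤ := n - μ.2.2 + μ.1
  set b : ℤ := n - μ.2.2 + μ.2.1
  have hΛ : 0 ≤ (1 + ε₀) ^ ((5 : ℝ) * (n - μ.2.2) / 2) := (Real.rpow_pos_of_pos hε _).le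
  have hprod : |X i₁ a t * X i₂ b t - Y i₁ a t * Y i₂ b t| ≤ D a * A b + A a * D b := by
    have hid : X i₁ a t * X i₂ b t - Y i₁ a t * Y i₂ b t =
        (X i₁ a t - Y i₁ a t) * X i₂ b t + Y i₁ a t * (X i₂ b t - Y i₂ b t) := by ring
    rw [hid]
    refine (abs_add_le _ _).trans (add_le_add ?_ ?_)
    · rw [abs_mul]
      exact mul_le_mul (hD i₁ a) (hAX i₂ b) (abs_nonneg _) ((abs_nonneg _).trans (hD i₁ a))
    · rw [abs_mul]
      exact mul_le_mul (hAY i₁ a) (hD i₂ b) (abs_nonneg _) ((abs_nonneg _).trans (hAY i₁ a))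
  rw [abs_mul, abs_mul, abs_of_nonneg hΛ]
  exact mul_le_mul_of_nonneg_left hprod (mul_nonneg (abs_nonneg _) hΛ)

/-- On a nearest-neighbour shift set, a triad based at shell `n` reads only the shells `n−1, n, n+1`
and its clock exponent has `μ₃ ≥ 0`. [cite: Tao2016AveragedNS, §4 after (4.1) (the shift set); cell vocabulary, shift-set parametrised] -/
theorem IsNearestNeighbourSet.shells_mem_three (h𝕊 : IsNearestNeighbourSet 𝕊) {μ : ℤ × ℤ × ℤ}
    (hμ : μ ∈ 𝕊) (n : ℤ) :
    n - 1 ≤ n - μ.2.2 + μ.1 ∧ n - μ.2.2 + μ.1 ≤ n + 1 ∧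
      n - 1 ≤ n - μ.2.2 + μ.2.1 ∧ n - μ.2.2 + μ.2.1 ≤ n + 1 ∧ (0 : ℝ) ≤ μ.2.2 := by
  obtain ⟨h1, h2, h3⟩ := h𝕊 μ hμ
  refine ⟨?_, ?_, ?_, ?_, ?_⟩
  · rcases h1 with h | h <;> rcases h3 with h' | h' <;> omega
  · rcases h1 with h | h <;> rcases h3 with h' | h' <;> omega
  · rcases h2 with h | h <;> rcases h3 with h' | h' <;> omega
  · rcases h2 with h | h <;> rcases h3 with h' | h' <;> omega
  · rcases h3 with h | h <;> simp [h]

/-- **Three-shell form of the bilinear difference bound** on a NEAREST-NEIGHBOUR shift set (`ε₀ ≥ 0`):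
if moreover `A_k ≤ A⋆` and `D_k ≤ D⋆` on the shells `n−1, n, n+1`, then
`|quadTermOn(X)_{i,n} − quadTermOn(Y)_{i,n}| ≤ 2 (∑_{i₁,i₂,μ∈𝕊} |α_{i₁i₂iμ}|) (1+ε₀)^{5n/2} A⋆ D⋆`.
[cite: Tao2016AveragedNS, §4 (4.8) (the bilinear term)] -/
theorem abs_quadTermOn_sub_quadTermOn_le_of_le (h𝕊 : IsNearestNeighbourSet 𝕊) (ε₀ : ℝ) (hε : 0 ≤ ε₀)
    (α : Fin m → Fin m → Fin m → ℤ × ℤ × ℤ → ℝ) (X Y : Fin m → ℤ → ℝ → ℝ) (i : Fin m) (n : ℤ)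
    (t : ℝ) {A D : ℤ → ℝ} {Amax Dmax : ℝ} (hAX : ∀ j k, |X j k t| ≤ A k)
    (hAY : ∀ j k, |Y j k t| ≤ A k) (hD : ∀ j k, |X j k t - Y j k t| ≤ D k)
    (hA3 : ∀ k, n - 1 ≤ k → k ≤ n + 1 → A k ≤ Amax) (hD3 : ∀ k, n - 1 ≤ k → k ≤ n + 1 → D k ≤ Dmax) :
    |quadTermOn 𝕊 ε₀ α X i n t - quadTermOn 𝕊 ε₀ α Y i n t| ≤
      2 * (∑ i₁, ∑ i₂, ∑ μ ∈ 𝕊, |α i₁ i₂ i μ|) * (1 + ε₀) ^ ((5 : ℝ) * n / 2) * Amax * Dmax := by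
  have hq : 0 < 1 + ε₀ := by linarith
  have hq1 : 1 ≤ 1 + ε₀ := by linarith
  refine (abs_quadTermOn_sub_quadTermOn_le ε₀ hq α X Y i n t hAX hAY hD).trans ?_
  have hterm : ∀ (i₁ i₂ : Fin m), ∀ μ ∈ 𝕊,
      |α i₁ i₂ i μ| * (1 + ε₀) ^ ((5 : ℝ) * (n - μ.2.2) / 2) *
          (D (n - μ.2.2 + μ.1) * A (n - μ.2.2 + μ.2.1) +
            A (n - μ.2.2 + μ.1) * D (n - μ.2.2 + μ.2.1)) ≤
        |α i₁ i₂ i μ| * ((1 + ε₀) ^ ((5 : ℝ) * n / 2) * (2 * Amax * Dmax)) := by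
    intro i₁ i₂ μ hμ
    obtain ⟨ha1, ha2, hb1, hb2, hμ3⟩ := IsNearestNeighbourSet.shells_mem_three h𝕊 hμ n
    set a : ℤ := n - μ.2.2 + μ.1
    set b : ℤ := n - μ.2.2 + μ.2.1
    have hA0 : ∀ k, 0 ≤ A k := fun k => (abs_nonneg _).trans (hAX i₁ k)
    have hD0 : ∀ k, 0 ≤ D k := fun k => (abs_nonneg _).trans (hD i₁ k)
    have hΛ : (1 + ε₀) ^ ((5 : ℝ) * (n - μ.2.2) / 2) ≤ (1 + ε₀) ^ ((5 : ℝ) * n / 2) :=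
      Real.rpow_le_rpow_of_exponent_le hq1 (by nlinarith)
    have hΛ0 : 0 ≤ (1 + ε₀) ^ ((5 : ℝ) * (n - μ.2.2) / 2) := (Real.rpow_pos_of_pos hq _).le
    have hin : D a * A b + A a * D b ≤ 2 * Amax * Dmax := by
      have h1 : D a * A b ≤ Dmax * Amax :=
        mul_le_mul (hD3 a ha1 ha2) (hA3 b hb1 hb2) (hA0 b) ((hD0 a).trans (hD3 a ha1 ha2))
      have h2 : A a * D b ≤ Amax * Dmax :=
        mul_le_mul (hA3 a ha1 ha2) (hD3 b hb1 hb2) (hD0 b) ((hA0 a).trans (hA3 a ha1 ha2))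
      linarith
    have hin0 : 0 ≤ D a * A b + A a * D b := by
      have := hA0 a; have := hA0 b; have := hD0 a; have := hD0 b; positivity
    rw [mul_assoc]
    refine mul_le_mul_of_nonneg_left ?_ (abs_nonneg _)
    exact mul_le_mul hΛ hin hin0 (hΛ0.trans hΛ)
  calc ∑ i₁, ∑ i₂, ∑ μ ∈ 𝕊, |α i₁ i₂ i μ| * (1 + ε₀) ^ ((5 : ℝ) * (n - μ.2.2) / 2) *
          (D (n - μ.2.2 + μ.1) * A (n - μ.2.2 + μ.2.1) +
            A (n - μ.2.2 + μ.1) * D (n - μ.2.2 + μ.2.1))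
      ≤ ∑ i₁, ∑ i₂, ∑ μ ∈ 𝕊, |α i₁ i₂ i μ| * ((1 + ε₀) ^ ((5 : ℝ) * n / 2) * (2 * Amax * Dmax)) :=
        Finset.sum_le_sum fun i₁ _ => Finset.sum_le_sum fun i₂ _ =>
          Finset.sum_le_sum fun μ hμ => hterm i₁ i₂ μ hμ
    _ = 2 * (∑ i₁, ∑ i₂, ∑ μ ∈ 𝕊, |α i₁ i₂ i μ|) * (1 + ε₀) ^ ((5 : ℝ) * n / 2) * Amax * Dmax := by
        simp only [← Finset.sum_mul]
        ring

/-- **Crude size of the nonlinearity from a uniform amplitude bound** (nearest-neighbour `𝕊`, `ε₀ ≥ 0`):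
`|quadTermOn(X)_{i,n}(t)| ≤ 2 (∑_{i₁,i₂,μ∈𝕊}|α_{i₁i₂iμ}|) (1+ε₀)^{5n/2} M²` if `|X_{j,k}(t)| ≤ M` for all
modes and shells. [cite: Tao2016AveragedNS, §4 (4.8)] -/
theorem abs_quadTermOn_le_of_uniform (h𝕊 : IsNearestNeighbourSet 𝕊) {ε₀ : ℝ} (hε : 0 ≤ ε₀)
    (α : Fin m → Fin m → Fin m → ℤ × ℤ × ℤ → ℝ) (X : Fin m → ℤ → ℝ → ℝ) (i : Fin m) (n : ℤ) (t : ℝ)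
    {M : ℝ} (hM : ∀ (j : Fin m) (k : ℤ), |X j k t| ≤ M) :
    |quadTermOn 𝕊 ε₀ α X i n t| ≤
      2 * (∑ i₁, ∑ i₂, ∑ μ ∈ 𝕊, |α i₁ i₂ i μ|) * (1 + ε₀) ^ ((5 : ℝ) * n / 2) * M * M := by
  have h := abs_quadTermOn_sub_quadTermOn_le_of_le h𝕊 ε₀ hε α X (fun _ _ _ => (0 : ℝ)) i n t
    (A := fun _ => M) (D := fun _ => M) (Amax := M) (Dmax := M) hM
    (fun j k => by simpa using (abs_nonneg (X j k t)).trans (hM j k))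
    (fun j k => by simpa using hM j k) (fun _ _ _ => le_rfl) (fun _ _ _ => le_rfl)
  rwa [quadTermOn_zero_family, sub_zero] at h

/-- **THREE-SHELL size of the nonlinearity** (nearest-neighbour `𝕊`, `ε₀ ≥ 0`): if the amplitudes of
the three shells `n−1, n, n+1` are bounded by `A⋆ ≥ 0` at time `t` (no hypothesis on other shells),
then `|quadTermOn(X)_{i,n}(t)| ≤ 2 (∑_{i₁,i₂,μ∈𝕊}|α_{i₁i₂iμ}|) (1+ε₀)^{5n/2} A⋆²` — the input of every
tail / frozen-shell estimate. [cite: Tao2016AveragedNS, §4 (4.8)] -/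
theorem abs_quadTermOn_le_three_shell (h𝕊 : IsNearestNeighbourSet 𝕊) {ε₀ : ℝ} (hε : 0 ≤ ε₀)
    (α : Fin m → Fin m → Fin m → ℤ × ℤ × ℤ → ℝ) (X : Fin m → ℤ → ℝ → ℝ) (i : Fin m) (n : ℤ) (t : ℝ)
    {Amax : ℝ} (hA0 : 0 ≤ Amax)
    (hA : ∀ (j : Fin m) (k : ℤ), n - 1 ≤ k → k ≤ n + 1 → |X j k t| ≤ Amax) :
    |quadTermOn 𝕊 ε₀ α X i n t| ≤
      2 * (∑ i₁, ∑ i₂, ∑ μ ∈ 𝕊, |α i₁ i₂ i μ|) * (1 + ε₀) ^ ((5 : ℝ) * n / 2) * Amax * Amax := by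
  -- profile: the true amplitude at every shell, capped by `A⋆` on the three shells
  have h := abs_quadTermOn_sub_quadTermOn_le_of_le h𝕊 ε₀ hε α X (fun _ _ _ => (0 : ℝ)) i n t
    (A := fun k => ⨆ j : Fin m, |X j k t|) (D := fun k => ⨆ j : Fin m, |X j k t|)
    (Amax := Amax) (Dmax := Amax)
    (fun j k => le_ciSup (f := fun j : Fin m => |X j k t|) (Set.finite_range _).bddAbove j)
    (fun j k => by simpa using Real.iSup_nonneg (f := fun j : Fin m => |X j k t|) fun _ => abs_nonneg _)
    (fun j k => by
      simpa using le_ciSup (f := fun j : Fin m => |X j k t|) (Set.finite_range _).bddAbove j)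
    (fun k hk1 hk2 => ?_) (fun k hk1 hk2 => ?_)
  · rwa [quadTermOn_zero_family, sub_zero] at h
  all_goals
    rcases isEmpty_or_nonempty (Fin m) with hm | hm
    · simp [hA0]
    · exact ciSup_le fun j => hA j k hk1 hk2

variable {τ ε₀ : ℝ} {α : Fin m → Fin m → Fin m → ℤ × ℤ × ℤ → ℝ} {κ₁ κ₂ κ₂' : ℝ}
  {S₀ F₀ B₀ S₀' F₀' B₀' : Fin m → ℤ → ℝ} {S F S' F' : Fin m → ℤ → ℝ → ℝ}

/-! ### Uniform time-Lipschitz bound for the deviation of two flows -/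

/-- **Uniform time-Lipschitz bound for the deviation** (nearest-neighbour `𝕊`, `ε₀ ≥ 0`). Let `S` be a
pseudo-flow with motion defect `κ₁ ≥ 0` and `S'` a defect-free flow on `[0, τ]`, with uniform bounds
`|S_{j,k}(u)|, |S'_{j,k}(u)|, √F_{j,k}(u) ≤ M` on `[0, τ]` (cf. `pseudoFlowOnShift_uniform_bounds`).
Then for every mode `i`, shell `n` and `s, t ∈ [0, τ]`:
`|(S − S')_{i,n}(t) − (S − S')_{i,n}(s)| ≤ (4 (∑|α_{··i·}|_𝕊) (1+ε₀)^{5n/2} M² + κ₁ (1+ε₀)^{2n} M) |t − s|`.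
[cite: Tao2016AveragedNS, §4 Lemma 4.1 (4.5), (4.8)] -/
theorem pseudoFlowOnShift_sub_lipschitz (h𝕊 : IsNearestNeighbourSet 𝕊)
    (h : PseudoFlowOnShift 𝕊 τ ε₀ α κ₁ κ₂ S₀ F₀ B₀ S F)
    (h' : PseudoFlowOnShift 𝕊 τ ε₀ α 0 κ₂' S₀' F₀' B₀' S' F') (hε : 0 ≤ ε₀) (hκ₁ : 0 ≤ κ₁) {M : ℝ}
    (hM : ∀ u ∈ Icc 0 τ, ∀ (j : Fin m) (k : ℤ),
      |S j k u| ≤ M ∧ |S' j k u| ≤ M ∧ Real.sqrt (F j k u) ≤ M)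
    (i : Fin m) (n : ℤ) {s t : ℝ} (hs : s ∈ Icc 0 τ) (ht : t ∈ Icc 0 τ) :
    |(S i n t - S' i n t) - (S i n s - S' i n s)| ≤
      (4 * (∑ i₁, ∑ i₂, ∑ μ ∈ 𝕊, |α i₁ i₂ i μ|) * (1 + ε₀) ^ ((5 : ℝ) * n / 2) * M * M +
        κ₁ * (1 + ε₀) ^ ((2 : ℝ) * n) * M) * |t - s| := by
  have hq : 0 < 1 + ε₀ := by linarith
  set C : ℝ := ∑ i₁ : Fin m, ∑ i₂ : Fin m, ∑ μ ∈ 𝕊, |α i₁ i₂ i μ| with hC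
  set Λ : ℝ := (1 + ε₀) ^ ((5 : ℝ) * n / 2) with hΛ
  have hLS : ∀ u ∈ Icc 0 τ, |quadTermOn 𝕊 ε₀ α S i n u| +
      κ₁ * (1 + ε₀) ^ ((2 : ℝ) * n) * Real.sqrt (F i n u) ≤
      2 * C * Λ * M * M + κ₁ * (1 + ε₀) ^ ((2 : ℝ) * n) * M := by
    intro u hu
    have h1 := abs_quadTermOn_le_of_uniform h𝕊 hε α S i n u (fun j k => (hM u hu j k).1)
    have h2 : κ₁ * (1 + ε₀) ^ ((2 : ℝ) * n) * Real.sqrt (F i n u) ≤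
        κ₁ * (1 + ε₀) ^ ((2 : ℝ) * n) * M :=
      mul_le_mul_of_nonneg_left (hM u hu i n).2.2 (mul_nonneg hκ₁ (Real.rpow_pos_of_pos hq _).le)
    simp only [hC, hΛ] at h1 ⊢
    linarith
  have hLS' : ∀ u ∈ Icc 0 τ, |quadTermOn 𝕊 ε₀ α S' i n u| +
      0 * (1 + ε₀) ^ ((2 : ℝ) * n) * Real.sqrt (F' i n u) ≤ 2 * C * Λ * M * M := by
    intro u hu
    have h1 := abs_quadTermOn_le_of_uniform h𝕊 hε α S' i n u (fun j k => (hM u hu j k).2.1)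
    simp only [hC, hΛ] at h1 ⊢
    linarith
  have hS := pseudoFlowOnShift_abs_sub_le h i n hLS hs ht
  have hS' := pseudoFlowOnShift_abs_sub_le h' i n hLS' hs ht
  have htri : |(S i n t - S' i n t) - (S i n s - S' i n s)| ≤
      |S i n t - S i n s| + |S' i n t - S' i n s| := by
    have := abs_sub (S i n t - S i n s) (S' i n t - S' i n s)
    have heq : (S i n t - S' i n t) - (S i n s - S' i n s) =
        (S i n t - S i n s) - (S' i n t - S' i n s) := by ring
    rw [heq]; exact this
  calc |(S i n t - S' i n t) - (S i n s - S' i n s)|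
      ≤ |S i n t - S i n s| + |S' i n t - S' i n s| := htri
    _ ≤ (2 * C * Λ * M * M + κ₁ * (1 + ε₀) ^ ((2 : ℝ) * n) * M) * |t - s| +
          (2 * C * Λ * M * M) * |t - s| := add_le_add hS hS'
    _ = (4 * C * Λ * M * M + κ₁ * (1 + ε₀) ^ ((2 : ℝ) * n) * M) * |t - s| := by ring

end GappedFrontRobustOn

end Summit.NavierStokesRegularity.NavierStokesRegularity.Theorems

end
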